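import Summits.AnomalousDissipation.AnomalousDissipation.Theorems.SolenoidalFractalHomogenisationRealisedQuasiStaticCellLawSlavedSlotIn
import Summits.AnomalousDissipation.AnomalousDissipation.Theorems.SolenoidalFractalHomogenisationRealisedQuasiStaticCellLawSectorWindow
import HarnessLib

/-!
# K2R `RealisedQuasiStaticCellLaw`, line `floquet-bloch`, stub `stub_lowSectorDecay` (S1D): contraction of the WEIGHTED
# sector energy of the Galerkin truncation over one full slot (weak coupling)

Summits-side helper file (everything proved; no definitions, no named facts; `--supports stmt-AnomalousDissipation-20446`).
Weak-coupling counterpart of `sectorWindow_contraction` (`…SectorWindow`). The weighted sector energy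
`Ψ_β(t) = β·Σ_{k ∈ freqBall N} ‖α_N(t)(k)‖² − (β − 1)(‖α_N(t)(ℓ)‖² + ‖α_N(t)(−ℓ)‖²)` (slow modes `±ℓ` with weight `1`, all
other modes of the sector with weight `β ≥ 1`) does not refer to any slot; inside slot `j` it splits as
`β·E_F + 2(Φ_out + Φ_in)` over the rest block `F` and the two weighted block energies of the principal coset `ℓ + ℤK_j`
(the conjugate coset carries the same energies). Over the FULL slot `[pP + start j, pP + start j + τ_j]` the blocks
contract by `outOfPlane_slot_contraction` / `inPlane_slot_contraction` and the rest block by plain diffusion at rate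
`8π²κ(n/2)²` (`restBlock_decay_fullSlot`, the window lemma `restBlock_decay_slot` extended to the closed slot by continuity),
so `Ψ_β(end) ≤ max(θ_F, θ_out, θ_in)·Ψ_β(start)` (`slavedSector_slot_contraction`), uniformly in `N`.
-/

set_option linter.dupNamespace false

noncomputable section

namespace Summit.AnomalousDissipation.AnomalousDissipation.Theorems.SolenoidalFractalHomogenisation.RealisedQuasiStaticCellLaw

open Set MeasureTheory Filter Topology Function Complex Matrix
open scoped InnerProductSpace ComplexConjugate Matrix
open Literature.Analysis Literature.Analysis.FunctionSpaces Literature.Analysis.FunctionSpaces.Torus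
open Literature.Analysis.FluidPDE Literature.Analysis.FluidPDE.LatticeShear
open Summit.AnomalousDissipation.AnomalousDissipation.Theorems.SolenoidalFractalHomogenisation.PermissibleCarrier

variable {k₀ : ℕ}

/-- **Rest-block decay over a full slot.** The window lemma `restBlock_decay_slot` on `[a, t]` for every `t` before the
end `a + τ_j` of slot `j` of the `p`-th period (`a = pP + start j`), passed to the limit `t → a + τ_j` by continuity of the
Galerkin coefficients (at the end of the last slot of a period the replayed phase jumps, so the window lemma does not apply
at that instant itself). -/
theorem restBlock_decay_fullSlot (W : LatticeWord k₀) {n : ℕ} (hn : 0 < n) {κ : ℝ} (hκ : 0 ≤ κ)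
    (ℓ : Fin 3 → ℤ) {w₀ : UnitAddTorus (Fin 3) → EuclideanSpace ℝ (Fin 3)}
    (hw₀ : FunctionSpaces.Torus.MemSobolev 1 (FunctionSpaces.EuclideanSpace.complexify ∘ w₀))
    (hdiv : FunctionSpaces.Torus.IsWeaklyDivFree w₀) (hmean : FunctionSpaces.Torus.HasZeroMean w₀)
    (hsupp : ∀ k : Fin 3 → ℤ, ¬ ((∃ z : Fin 3 → ℤ, k = ℓ + (n:ℤ) • z) ∨ (∃ z : Fin 3 → ℤ, k = -ℓ + (n:ℤ) • z)) →
      UnitAddTorus.mFourierCoeff (FunctionSpaces.EuclideanSpace.complexify ∘ w₀) k = 0)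
    {N : ℕ} (hBN : (Finset.univ.biUnion fun j : Fin k₀ =>
        ({(fun i => (W.phase j).m i * n), -(fun i => (W.phase j).m i * n)} : Finset (Fin 3 → ℤ))) ⊆ freqBall N)
    {T : ℝ} (p : ℕ) (j : Fin k₀) (hT : (p : ℝ) * W.period + W.start j + (W.phase j).τ ≤ T)
    {F : Finset (Fin 3 → ℤ)} (hFS : F ⊆ freqBall N) (hF : ∀ k ∈ F, -k ∈ F)
    (hFadd : ∀ k ∈ F, k + (fun i => (W.phase j).m i * (n : ℤ)) ∈ freqBall N → k + (fun i => (W.phase j).m i * (n : ℤ)) ∈ F)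
    (hFsub : ∀ k ∈ F, k - (fun i => (W.phase j).m i * (n : ℤ)) ∈ freqBall N → k - (fun i => (W.phase j).m i * (n : ℤ)) ∈ F)
    {R : ℝ} (hR : ∀ t ∈ Icc ((p : ℝ) * W.period + W.start j) ((p : ℝ) * W.period + W.start j + (W.phase j).τ),
      ∀ k ∈ F, freqNormSq k < R ^ 2 → (pvSetup_cell W hn hκ ℓ hw₀ hdiv hmean hsupp).galerkinCoeffAt N t k = 0) :
    ∑ k ∈ F, ‖(pvSetup_cell W hn hκ ℓ hw₀ hdiv hmean hsupp).galerkinCoeffAt N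
        ((p : ℝ) * W.period + W.start j + (W.phase j).τ) k‖ ^ 2 ≤
      Real.exp (-(8 * Real.pi ^ 2 * κ * R ^ 2) * (W.phase j).τ) *
        ∑ k ∈ F, ‖(pvSetup_cell W hn hκ ℓ hw₀ hdiv hmean hsupp).galerkinCoeffAt N ((p : ℝ) * W.period + W.start j) k‖ ^ 2 := by
  classical
  set hPV := pvSetup_cell W hn hκ ℓ hw₀ hdiv hmean hsupp with hPVdef
  obtain ⟨a, ha⟩ : ∃ a : ℝ, a = (p : ℝ) * W.period + W.start j := ⟨_, rfl⟩
  obtain ⟨b, hb⟩ : ∃ b : ℝ, b = (p : ℝ) * W.period + W.start j + (W.phase j).τ := ⟨_, rfl⟩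
  rw [← hb, ← ha]
  rw [← hb, ← ha] at hR
  have hτ : 0 < (W.phase j).τ := (W.phase j).τ_pos
  have hP : 0 < W.period := period_pos W
  have hab : a < b := by rw [ha, hb]; linarith
  have ha0 : 0 ≤ a := by have := start_nonneg W j; rw [ha]; positivity
  have hbT : b ≤ T := by rw [hb]; exact hT
  have hbP : b ≤ (p + 1 : ℝ) * W.period := by have := start_add_tau_le_period W j; rw [hb]; linarith
  -- the window lemma on `[a, t]`, `t < b`
  have hwin : ∀ t, t < b → ∀ s ∈ Icc a t, Int.fract (s / W.period) * W.period ∈ Icc (W.start j) (W.start j + (W.phase j).τ) := by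
    intro t htb s hs
    have e : s = (p : ℤ) * W.period + (s - p * W.period) := by push_cast; ring
    have hs0 : 0 ≤ s - p * W.period := by rw [ha] at hs; linarith [hs.1, start_nonneg W j]
    have hsP : s - p * W.period < W.period := by linarith [hs.2]
    rw [e, fract_period_mul hP (p : ℤ) hs0 hsP]
    rw [ha] at hs; rw [hb] at htb
    constructor <;> linarith [hs.1, hs.2]
  have hle : ∀ t ∈ Ico a b, ∑ k ∈ F, ‖hPV.galerkinCoeffAt N t k‖ ^ 2 ≤
      Real.exp (-(8 * Real.pi ^ 2 * κ * R ^ 2) * (t - a)) * ∑ k ∈ F, ‖hPV.galerkinCoeffAt N a k‖ ^ 2 := by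
    intro t ht
    exact restBlock_decay_slot W hn hκ ℓ hw₀ hdiv hmean hsupp hBN ha0 (ht.2.le.trans hbT) j (hwin t ht.2) hFS hF hFadd hFsub
      (fun s hs k hk hlt => hR s ⟨hs.1, hs.2.trans ht.2.le⟩ k hk hlt) t ⟨ht.1, le_rfl⟩
  -- pass to the limit `t → b⁻`
  have hcont : ∀ k ∈ F, ContinuousWithinAt (fun t => hPV.galerkinCoeffAt N t k) (Icc 0 T) b := fun k hk =>
    (hPV.hasDerivWithinAt_galerkinCoeffAt hBN (hFS hk) ⟨ha0.trans hab.le, hbT⟩).continuousWithinAt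
  have hsub : Ico a b ⊆ Icc 0 T := fun t ht => ⟨ha0.trans ht.1, ht.2.le.trans hbT⟩
  have hlim1 : Tendsto (fun t => ∑ k ∈ F, ‖hPV.galerkinCoeffAt N t k‖ ^ 2) (𝓝[Ico a b] b)
      (𝓝 (∑ k ∈ F, ‖hPV.galerkinCoeffAt N b k‖ ^ 2)) := by
    refine tendsto_finsetSum F fun k hk => ?_
    exact (((hcont k hk).mono hsub).norm.pow 2).tendsto
  have hlim2 : Tendsto (fun t => Real.exp (-(8 * Real.pi ^ 2 * κ * R ^ 2) * (t - a)) * ∑ k ∈ F, ‖hPV.galerkinCoeffAt N a k‖ ^ 2)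
      (𝓝[Ico a b] b) (𝓝 (Real.exp (-(8 * Real.pi ^ 2 * κ * R ^ 2) * (b - a)) * ∑ k ∈ F, ‖hPV.galerkinCoeffAt N a k‖ ^ 2)) := by
    have hc : Continuous (fun t : ℝ => Real.exp (-(8 * Real.pi ^ 2 * κ * R ^ 2) * (t - a)) *
        ∑ k ∈ F, ‖hPV.galerkinCoeffAt N a k‖ ^ 2) := by fun_prop
    exact (hc.tendsto b).mono_left nhdsWithin_le_nhds
  haveI : (𝓝[Ico a b] b).NeBot := by
    rw [← mem_closure_iff_nhdsWithin_neBot, closure_Ico hab.ne]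
    exact right_mem_Icc.2 hab.le
  have hev : ∀ᶠ t in 𝓝[Ico a b] b, ∑ k ∈ F, ‖hPV.galerkinCoeffAt N t k‖ ^ 2 ≤
      Real.exp (-(8 * Real.pi ^ 2 * κ * R ^ 2) * (t - a)) * ∑ k ∈ F, ‖hPV.galerkinCoeffAt N a k‖ ^ 2 :=
    eventually_nhdsWithin_of_forall fun t ht => hle t ht
  have h := le_of_tendsto_of_tendsto hlim1 hlim2 hev
  have eba : b - a = (W.phase j).τ := by rw [ha, hb]; ring
  rw [eba] at h
  exact h

set_option maxHeartbeats 400000 in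
/-- **Weighted sector energy: contraction over one full slot (weak coupling).** In the setting of
`outOfPlane_slot_contraction` / `inPlane_slot_contraction` for the principal coset of the sector label `ℓ` itself
(`k₀ = ℓ`, `2|ℓ| ≤ n`, the two principal cosets `±(ℓ + ℤK_j)` disjoint), with `β ≥ 1`: the weighted sector energy
`Ψ_β = β·Σ_{k∈freqBall N} ‖α_N(k)‖² − (β−1)(‖α_N(ℓ)‖² + ‖α_N(−ℓ)‖²)` of the Galerkin truncation contracts over the slot
`[pP + start j, pP + start j + τ_j]` by any `Θ` dominating the three factors: rest block `exp(−8π²κ(n/2)²τ_j)`,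
out-of-plane and in-plane weighted blocks (their `exp(−2Λτ_j(d₀ + (1−ε)σ g₁²(1−4ρ/3)) + slack)`). -/
theorem slavedSector_slot_contraction (W : LatticeWord k₀) {n : ℕ} (hn : 0 < n) {κ : ℝ} (hκ : 0 < κ)
    (ℓ : Fin 3 → ℤ) (hℓn : 2 * ‖latticeVec ℓ‖ ≤ n) {w₀ : UnitAddTorus (Fin 3) → EuclideanSpace ℝ (Fin 3)}
    (hw₀ : FunctionSpaces.Torus.MemSobolev 1 (FunctionSpaces.EuclideanSpace.complexify ∘ w₀))
    (hdiv : FunctionSpaces.Torus.IsWeaklyDivFree w₀) (hmean : FunctionSpaces.Torus.HasZeroMean w₀)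
    (hsupp : ∀ k : Fin 3 → ℤ, ¬ ((∃ z : Fin 3 → ℤ, k = ℓ + (n:ℤ) • z) ∨ (∃ z : Fin 3 → ℤ, k = -ℓ + (n:ℤ) • z)) →
      UnitAddTorus.mFourierCoeff (FunctionSpaces.EuclideanSpace.complexify ∘ w₀) k = 0)
    {N : ℕ} (hBN : (Finset.univ.biUnion fun j : Fin k₀ =>
        ({(fun i => (W.phase j).m i * n), -(fun i => (W.phase j).m i * n)} : Finset (Fin 3 → ℤ))) ⊆ freqBall N)
    {T : ℝ} (p : ℕ) (j : Fin k₀) (hT : (p : ℝ) * W.period + W.start j + (W.phase j).τ ≤ T)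
    (hk : ∀ J : ℤ, ℓ + J • (fun i => (W.phase j).m i * (n : ℤ)) ∈ freqBall N →
      ℓ + J • (fun i => (W.phase j).m i * (n : ℤ)) ≠ 0)
    (hdisj : ∀ J J' : ℤ, ℓ + J • (fun i => (W.phase j).m i * (n : ℤ)) ≠ -(ℓ + J' • (fun i => (W.phase j).m i * (n : ℤ))))
    {ζr : Fin 3 → ℝ} (hζ1 : ζr ⬝ᵥ ζr = 1) (hζ0 : ζr ⬝ᵥ (fun i => ((ℓ i : ℤ) : ℝ)) = 0)
    (hζK : ζr ⬝ᵥ (fun i => (((fun i => (W.phase j).m i * (n : ℤ)) i : ℤ) : ℝ)) = 0)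
    {pf : ℤ → Fin 3 → ℝ}
    (hp : ∀ J : ℤ, pf J = (Real.sqrt ((fun i => (((ℓ + J • (fun i => (W.phase j).m i * (n : ℤ))) i : ℤ) : ℝ)) ⬝ᵥ
        (fun i => (((ℓ + J • (fun i => (W.phase j).m i * (n : ℤ))) i : ℤ) : ℝ))))⁻¹ •
        (fun i => (((ℓ + J • (fun i => (W.phase j).m i * (n : ℤ))) i : ℤ) : ℝ)) ⨯₃ ζr)
    {Wset : Finset ℤ} (hW : ∀ J : ℤ, J ∈ Wset ↔ ℓ + J • (fun i => (W.phase j).m i * (n : ℤ)) ∈ freqBall N)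
    (h0 : (0 : ℤ) ∈ Wset) (h1 : (1 : ℤ) ∈ Wset) (hm1 : (-1 : ℤ) ∈ Wset)
    (hs : ∀ J ∈ Wset, |pf J ⬝ᵥ pf (J + 1)| ≤ 1)
    (Λ Δ ε β σo σi g₁ : ℝ) (hΛ : Λ = κ * (4 * Real.pi ^ 2 * freqNormSq (fun i => (W.phase j).m i * (n : ℤ))))
    (hΔ0 : 0 < Δ) (hε : 0 ≤ ε) (hβ : 1 ≤ β)
    (hgap : ∀ J ∈ Wset, J ≠ 0 →
      freqNormSq ℓ / freqNormSq (fun i => (W.phase j).m i * (n : ℤ)) + Δ ≤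
        freqNormSq (ℓ + J • (fun i => (W.phase j).m i * (n : ℤ))) / freqNormSq (fun i => (W.phase j).m i * (n : ℤ)))
    (hσo : σo = 1 / (freqNormSq (ℓ + (-1 : ℤ) • (fun i => (W.phase j).m i * (n : ℤ))) /
          freqNormSq (fun i => (W.phase j).m i * (n : ℤ)) - freqNormSq ℓ / freqNormSq (fun i => (W.phase j).m i * (n : ℤ))) +
        1 / (freqNormSq (ℓ + (1 : ℤ) • (fun i => (W.phase j).m i * (n : ℤ))) /
          freqNormSq (fun i => (W.phase j).m i * (n : ℤ)) - freqNormSq ℓ / freqNormSq (fun i => (W.phase j).m i * (n : ℤ))))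
    (hσi : σi = (pf (-1) ⬝ᵥ pf 0) ^ 2 / (freqNormSq (ℓ + (-1 : ℤ) • (fun i => (W.phase j).m i * (n : ℤ))) /
          freqNormSq (fun i => (W.phase j).m i * (n : ℤ)) - freqNormSq ℓ / freqNormSq (fun i => (W.phase j).m i * (n : ℤ))) +
        (pf 0 ⬝ᵥ pf 1) ^ 2 / (freqNormSq (ℓ + (1 : ℤ) • (fun i => (W.phase j).m i * (n : ℤ))) /
          freqNormSq (fun i => (W.phase j).m i * (n : ℤ)) - freqNormSq ℓ / freqNormSq (fun i => (W.phase j).m i * (n : ℤ))))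
    (hg₁ : g₁ = 2 * Real.pi * (∑ i, (W.phase j).e i * (ℓ i : ℝ)) *
        ‖Complex.exp ((W.phase j).φ * Complex.I) *
          (1 / (2 * ((2 * Real.pi * ‖latticeVec (W.phase j).m‖ : ℝ) : ℂ) * Complex.I))‖ * (1 / (n : ℝ)) / Λ)
    (hβo : 2 ≤ β * Δ * ε * σo) (hsmallo : g₁ ^ 2 * (4 * 2 / Δ + 2 * σo) ≤ Δ)
    (hβi : (pf 0 ⬝ᵥ pf 1) ^ 2 + (pf (-1) ⬝ᵥ pf 0) ^ 2 ≤ β * Δ * ε * σi)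
    (hsmalli : g₁ ^ 2 * (4 * ((pf 0 ⬝ᵥ pf 1) ^ 2 + (pf (-1) ⬝ᵥ pf 0) ^ 2) / Δ + 2 * σi) ≤ Δ)
    (Θ : ℝ) (hΘ : max (Real.exp (-(8 * Real.pi ^ 2 * κ * ((n : ℝ) / 2) ^ 2) * (W.phase j).τ))
        (max (Real.exp (-(2 * Λ * (W.phase j).τ * (freqNormSq ℓ / freqNormSq (fun i => (W.phase j).m i * (n : ℤ)) +
              (1 - ε) * σo * (g₁ ^ 2 * (1 - 4 * W.ramp / 3)))) +
            40 * β * 2 * Λ * (W.phase j).τ * g₁ ^ 4 * (1 + g₁ ^ 2 * σo ^ 2) / Δ ^ 3 +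
            48 * β * 2 * g₁ ^ 2 / (W.ramp * (W.phase j).τ * Λ * Δ ^ 3)))
          (Real.exp (-(2 * Λ * (W.phase j).τ * (freqNormSq ℓ / freqNormSq (fun i => (W.phase j).m i * (n : ℤ)) +
              (1 - ε) * σi * (g₁ ^ 2 * (1 - 4 * W.ramp / 3)))) +
            40 * β * ((pf 0 ⬝ᵥ pf 1) ^ 2 + (pf (-1) ⬝ᵥ pf 0) ^ 2) * Λ * (W.phase j).τ * g₁ ^ 4 * (1 + g₁ ^ 2 * σi ^ 2) / Δ ^ 3 +
            48 * β * ((pf 0 ⬝ᵥ pf 1) ^ 2 + (pf (-1) ⬝ᵥ pf 0) ^ 2) * g₁ ^ 2 / (W.ramp * (W.phase j).τ * Λ * Δ ^ 3)))) ≤ Θ) :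
    β * ∑ k ∈ freqBall N, ‖(pvSetup_cell W hn hκ.le ℓ hw₀ hdiv hmean hsupp).galerkinCoeffAt N
          ((p : ℝ) * W.period + W.start j + (W.phase j).τ) k‖ ^ 2 -
        (β - 1) * (‖(pvSetup_cell W hn hκ.le ℓ hw₀ hdiv hmean hsupp).galerkinCoeffAt N
            ((p : ℝ) * W.period + W.start j + (W.phase j).τ) ℓ‖ ^ 2 +
          ‖(pvSetup_cell W hn hκ.le ℓ hw₀ hdiv hmean hsupp).galerkinCoeffAt N
            ((p : ℝ) * W.period + W.start j + (W.phase j).τ) (-ℓ)‖ ^ 2) ≤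
      Θ * (β * ∑ k ∈ freqBall N, ‖(pvSetup_cell W hn hκ.le ℓ hw₀ hdiv hmean hsupp).galerkinCoeffAt N
            ((p : ℝ) * W.period + W.start j) k‖ ^ 2 -
        (β - 1) * (‖(pvSetup_cell W hn hκ.le ℓ hw₀ hdiv hmean hsupp).galerkinCoeffAt N
            ((p : ℝ) * W.period + W.start j) ℓ‖ ^ 2 +
          ‖(pvSetup_cell W hn hκ.le ℓ hw₀ hdiv hmean hsupp).galerkinCoeffAt N
            ((p : ℝ) * W.period + W.start j) (-ℓ)‖ ^ 2)) := by
  classical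
  set hPV := pvSetup_cell W hn hκ.le ℓ hw₀ hdiv hmean hsupp with hPVdef
  set K : Fin 3 → ℤ := fun i => (W.phase j).m i * (n : ℤ) with hK
  set ζc : EuclideanSpace ℂ (Fin 3) := WithLp.toLp 2 (Complex.ofReal ∘ ζr) with hζc
  obtain ⟨a, ha⟩ : ∃ a : ℝ, a = (p : ℝ) * W.period + W.start j := ⟨_, rfl⟩
  obtain ⟨b, hb⟩ : ∃ b : ℝ, b = (p : ℝ) * W.period + W.start j + (W.phase j).τ := ⟨_, rfl⟩
  -- complex transversality of `ζ`
  have hcast : ∀ k : Fin 3 → ℤ, ζr ⬝ᵥ (fun i => ((k i : ℤ) : ℝ)) = 0 → ∑ i, ((k i : ℤ) : ℂ) * ζc i = 0 := by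
    intro k hk0
    have e : ∑ i, ((k i : ℤ) : ℂ) * ζc i = (((ζr ⬝ᵥ fun i => ((k i : ℤ) : ℝ) : ℝ)) : ℂ) := by
      rw [dotProduct]; push_cast
      refine Finset.sum_congr rfl fun i _ => ?_
      simp [hζc, mul_comm]
    rw [e, hk0]; simp
  -- the two weighted blocks contract
  have hout := outOfPlane_slot_contraction W hn hκ ℓ hw₀ hdiv hmean hsupp hBN p j hT ℓ (hcast ℓ hζ0) (hcast _ hζK)
    hW h0 h1 hm1 Λ Δ ε β σo g₁ hΛ hΔ0 hε (by linarith) hgap hσo hg₁ hβo hsmallo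
  have hin := inPlane_slot_contraction W hn hκ ℓ hw₀ hdiv hmean hsupp hBN p j hT ℓ hk hζ1 hζ0 hζK hp hW h0 h1 hm1 hs
    Λ Δ ε β σi g₁ hΛ hΔ0 hε (by linarith) hgap hσi hg₁ hβi hsmalli
  rw [← hb, ← ha] at hout hin ⊢
  -- abbreviations for the three factors and the energies
  obtain ⟨θF, hθF⟩ : ∃ θ : ℝ, θ = Real.exp (-(8 * Real.pi ^ 2 * κ * ((n : ℝ) / 2) ^ 2) * (W.phase j).τ) := ⟨_, rfl⟩
  obtain ⟨θo, hθo⟩ : ∃ θ : ℝ, θ = Real.exp (-(2 * Λ * (W.phase j).τ * (freqNormSq ℓ / freqNormSq K +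
              (1 - ε) * σo * (g₁ ^ 2 * (1 - 4 * W.ramp / 3)))) +
            40 * β * 2 * Λ * (W.phase j).τ * g₁ ^ 4 * (1 + g₁ ^ 2 * σo ^ 2) / Δ ^ 3 +
            48 * β * 2 * g₁ ^ 2 / (W.ramp * (W.phase j).τ * Λ * Δ ^ 3)) := ⟨_, rfl⟩
  obtain ⟨θi, hθi⟩ : ∃ θ : ℝ, θ = Real.exp (-(2 * Λ * (W.phase j).τ * (freqNormSq ℓ / freqNormSq K +
              (1 - ε) * σi * (g₁ ^ 2 * (1 - 4 * W.ramp / 3)))) +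
            40 * β * ((pf 0 ⬝ᵥ pf 1) ^ 2 + (pf (-1) ⬝ᵥ pf 0) ^ 2) * Λ * (W.phase j).τ * g₁ ^ 4 * (1 + g₁ ^ 2 * σi ^ 2) / Δ ^ 3 +
            48 * β * ((pf 0 ⬝ᵥ pf 1) ^ 2 + (pf (-1) ⬝ᵥ pf 0) ^ 2) * g₁ ^ 2 / (W.ramp * (W.phase j).τ * Λ * Δ ^ 3)) := ⟨_, rfl⟩
  rw [← hθo] at hout
  rw [← hθi] at hin
  rw [← hθF, ← hθo, ← hθi] at hΘ
  have hθF0 : 0 ≤ θF := by rw [hθF]; positivity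
  have hθo0 : 0 ≤ θo := by rw [hθo]; positivity
  have hθi0 : 0 ≤ θi := by rw [hθi]; positivity
  set E : ℝ → (Fin 3 → ℤ) → ℝ := fun τ k => ‖hPV.galerkinCoeffAt N τ k‖ ^ 2 with hE
  have hE0 : ∀ τ k, 0 ≤ E τ k := fun τ k => by positivity
  set Eo : ℝ → ℤ → ℝ := fun τ J => ‖inner ℂ ζc (hPV.galerkinCoeffAt N τ (ℓ + J • K))‖ ^ 2 with hEo
  set Ei : ℝ → ℤ → ℝ := fun τ J => ‖inner ℂ (WithLp.toLp 2 (Complex.ofReal ∘ pf J) : EuclideanSpace ℂ (Fin 3))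
      (hPV.galerkinCoeffAt N τ (ℓ + J • K))‖ ^ 2 with hEi
  -- the partition of the ball
  set Pp : Finset (Fin 3 → ℤ) := Wset.image (fun J : ℤ => ℓ + J • K) with hPp
  set Pm : Finset (Fin 3 → ℤ) := Pp.image (fun k => -k) with hPm
  set U : Finset (Fin 3 → ℤ) := Pp ∪ Pm with hU
  set F : Finset (Fin 3 → ℤ) := freqBall N \ U with hF
  have hK0 : K ≠ 0 := cellFreq_ne_zero (W.phase j) hn
  have hPpS : Pp ⊆ freqBall N := by
    intro k hk'
    obtain ⟨J, hJ, rfl⟩ := Finset.mem_image.1 hk'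
    exact (hW J).1 hJ
  have hPmS : Pm ⊆ freqBall N := by
    intro k hk'
    obtain ⟨k', hk'P, rfl⟩ := Finset.mem_image.1 hk'
    exact neg_mem_freqBall_of_mem _ (hPpS hk'P)
  have hUS : U ⊆ freqBall N := Finset.union_subset hPpS hPmS
  have hPdisj : Disjoint Pp Pm := by
    rw [Finset.disjoint_left]
    intro k hkP hkM
    obtain ⟨J, _, rfl⟩ := Finset.mem_image.1 hkP
    obtain ⟨k', hk'P, hk'eq⟩ := Finset.mem_image.1 hkM
    obtain ⟨J', _, rfl⟩ := Finset.mem_image.1 hk'P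
    exact hdisj J J' hk'eq.symm
  -- sums over the pieces
  have hsplit : ∀ τ, ∑ k ∈ freqBall N, E τ k = 2 * ∑ J ∈ Wset, E τ (ℓ + J • K) + ∑ k ∈ F, E τ k := by
    intro τ
    have hPp_sum : ∑ k ∈ Pp, E τ k = ∑ J ∈ Wset, E τ (ℓ + J • K) := by
      rw [hPp, Finset.sum_image (fun J _ J' _ h => coset_injective hK0 ℓ h)]
    have hPm_sum : ∑ k ∈ Pm, E τ k = ∑ k ∈ Pp, E τ k := by
      rw [hPm, Finset.sum_image (fun k _ k' _ h => neg_injective h)]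
      refine Finset.sum_congr rfl fun k _ => ?_
      simp only [hE]
      rw [norm_galerkinCoeffAt_neg W hn hκ.le ℓ hw₀ hdiv hmean hsupp]
    rw [← Finset.sum_sdiff hUS, hU, Finset.sum_union hPdisj, hPm_sum, hPp_sum]
    ring
  -- the block split of the principal coset energies
  have hblocks : ∀ τ, ∀ J ∈ Wset, E τ (ℓ + J • K) = Eo τ J + Ei τ J := by
    intro τ J hJ
    simp only [hE, hEo, hEi]
    rw [hp J]
    exact norm_sq_galerkinCoeffAt_eq_blocks W hn hκ.le ℓ hw₀ hdiv hmean hsupp N τ j ℓ J (hk J ((hW J).1 hJ)) hζ1 hζ0 hζK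
  -- the weighted functional in slot form
  have hΨ : ∀ τ, β * ∑ k ∈ freqBall N, E τ k - (β - 1) * (E τ ℓ + E τ (-ℓ)) =
      β * ∑ k ∈ F, E τ k + 2 * ((Eo τ 0 + β * ∑ J ∈ Wset.erase 0, Eo τ J) + (Ei τ 0 + β * ∑ J ∈ Wset.erase 0, Ei τ J)) := by
    intro τ
    have hneg : E τ (-ℓ) = E τ ℓ := by
      simp only [hE]; rw [norm_galerkinCoeffAt_neg W hn hκ.le ℓ hw₀ hdiv hmean hsupp]
    have hℓ0 : E τ ℓ = Eo τ 0 + Ei τ 0 := by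
      have := hblocks τ 0 h0; simpa using this
    have hsumW : ∑ J ∈ Wset, E τ (ℓ + J • K) = (Eo τ 0 + Ei τ 0) + ∑ J ∈ Wset.erase 0, (Eo τ J + Ei τ J) := by
      rw [Finset.sum_congr rfl (hblocks τ), ← Finset.add_sum_erase Wset _ h0]
    rw [hsplit τ, hneg, hℓ0, hsumW, Finset.sum_add_distrib]
    ring
  -- the rest block: structure and decay
  have hFS : F ⊆ freqBall N := Finset.sdiff_subset
  have hmemPp : ∀ J : ℤ, ℓ + J • K ∈ freqBall N → ℓ + J • K ∈ Pp := fun J hJ =>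
    Finset.mem_image.2 ⟨J, (hW J).2 hJ, rfl⟩
  have hmemPm : ∀ J : ℤ, ℓ + J • K ∈ freqBall N → -(ℓ + J • K) ∈ Pm := fun J hJ =>
    Finset.mem_image.2 ⟨ℓ + J • K, hmemPp J hJ, rfl⟩
  have hUsymm : ∀ k ∈ U, -k ∈ U := by
    intro k hk'
    rw [hU, Finset.mem_union] at hk' ⊢
    rcases hk' with h | h
    · exact Or.inr (Finset.mem_image.2 ⟨k, h, rfl⟩)
    · obtain ⟨k', hk'P, rfl⟩ := Finset.mem_image.1 h
      rw [neg_neg]; exact Or.inl hk'P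
  have hFsymm : ∀ k ∈ F, -k ∈ F := by
    intro k hk'
    rw [hF, Finset.mem_sdiff] at hk' ⊢
    refine ⟨neg_mem_freqBall_of_mem _ hk'.1, fun h => hk'.2 ?_⟩
    have := hUsymm _ h
    rwa [neg_neg] at this
  have hUadd : ∀ k, k + K ∈ U → k ∈ freqBall N → k ∈ U := by
    intro k hkU hkS
    rw [hU, Finset.mem_union] at hkU ⊢
    rcases hkU with h | h
    · obtain ⟨J, _, hJk⟩ := Finset.mem_image.1 h
      have hk' : k = ℓ + (J - 1) • K := by rw [sub_smul, one_smul, ← add_sub_assoc, hJk]; abel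
      rw [hk'] at hkS ⊢
      exact Or.inl (hmemPp _ hkS)
    · obtain ⟨k', hk'P, hk'eq⟩ := Finset.mem_image.1 h
      obtain ⟨J, _, hJk⟩ := Finset.mem_image.1 hk'P
      have hk' : k = -(ℓ + (J + 1) • K) := by
        rw [add_smul, one_smul, ← add_assoc, hJk, neg_add, hk'eq]; abel
      rw [hk'] at hkS ⊢
      have hkS' : ℓ + (J + 1) • K ∈ freqBall N := by
        have := neg_mem_freqBall_of_mem _ hkS
        rwa [neg_neg] at this
      exact Or.inr (hmemPm _ hkS')
  have hUsub : ∀ k, k - K ∈ U → k ∈ freqBall N → k ∈ U := by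
    intro k hkU hkS
    have h1' : -k + K ∈ U := by
      have := hUsymm _ hkU
      rwa [neg_sub, sub_eq_neg_add] at this
    have h2 := hUadd (-k) h1' (neg_mem_freqBall_of_mem _ hkS)
    have := hUsymm _ h2
    rwa [neg_neg] at this
  have hFadd : ∀ k ∈ F, k + K ∈ freqBall N → k + K ∈ F := by
    intro k hkF hkS
    rw [hF, Finset.mem_sdiff] at hkF ⊢
    exact ⟨hkS, fun h => hkF.2 (hUadd k h hkF.1)⟩
  have hFsub : ∀ k ∈ F, k - K ∈ freqBall N → k - K ∈ F := by
    intro k hkF hkS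
    rw [hF, Finset.mem_sdiff] at hkF ⊢
    exact ⟨hkS, fun h => hkF.2 (hUsub k h hkF.1)⟩
  have hR : ∀ τ ∈ Icc a b, ∀ k ∈ F, freqNormSq k < ((n : ℝ) / 2) ^ 2 → hPV.galerkinCoeffAt N τ k = 0 := by
    intro τ _ k hkF hlt
    by_cases hsec : k ∈ ({k | (∃ z : Fin 3 → ℤ, k = ℓ + (n:ℤ) • z) ∨ (∃ z : Fin 3 → ℤ, k = -ℓ + (n:ℤ) • z)} :
        Set (Fin 3 → ℤ))
    · exfalso
      rw [hF, Finset.mem_sdiff] at hkF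
      rcases hsec with ⟨z, hz⟩ | ⟨z, hz⟩
      · by_cases hz0 : z = 0
        · subst hz0
          have hkℓ : k = ℓ + (0 : ℤ) • K := by rw [hz]; simp
          exact hkF.2 (by rw [hU, Finset.mem_union]; exact Or.inl (hkℓ ▸ hmemPp 0 (hkℓ ▸ hkF.1)))
        · exact absurd hlt (not_lt.2 (half_le_norm_of_sector hz0 hℓn (Or.inl hz)))
      · by_cases hz0 : z = 0
        · subst hz0
          have hkℓ : k = -(ℓ + (0 : ℤ) • K) := by rw [hz]; simp
          have hℓS : ℓ + (0 : ℤ) • K ∈ freqBall N := by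
            have := neg_mem_freqBall_of_mem _ hkF.1
            rwa [hkℓ, neg_neg] at this
          exact hkF.2 (by rw [hU, Finset.mem_union]; exact Or.inr (hkℓ ▸ hmemPm 0 hℓS))
        · exact absurd hlt (not_lt.2 (half_le_norm_of_sector hz0 hℓn (Or.inr hz)))
    · exact hPV.galerkinCoeffAt_eq_zero N τ (Or.inl hsec)
  have hFdec' := restBlock_decay_fullSlot W hn hκ.le ℓ hw₀ hdiv hmean hsupp hBN p j hT hFS hFsymm hFadd hFsub
    (R := (n : ℝ) / 2) (by rw [← hb, ← ha]; exact hR)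
  rw [← hb, ← ha, ← hθF] at hFdec'
  have hFdec : ∑ k ∈ F, E b k ≤ θF * ∑ k ∈ F, E a k := by simpa only [hE] using hFdec'
  have hout' : Eo b 0 + β * ∑ J ∈ Wset.erase 0, Eo b J ≤ θo * (Eo a 0 + β * ∑ J ∈ Wset.erase 0, Eo a J) := by
    simpa only [hEo, zero_smul, add_zero] using hout
  have hin' : Ei b 0 + β * ∑ J ∈ Wset.erase 0, Ei b J ≤ θi * (Ei a 0 + β * ∑ J ∈ Wset.erase 0, Ei a J) := by
    simpa only [hEi, zero_smul, add_zero] using hin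
  -- assemble
  have hβ0 : 0 ≤ β := zero_le_one.trans hβ
  have hEo0 : ∀ τ J, 0 ≤ Eo τ J := fun τ J => by simp only [hEo]; positivity
  have hEi0 : ∀ τ J, 0 ≤ Ei τ J := fun τ J => by simp only [hEi]; positivity
  have hFa0 : 0 ≤ ∑ k ∈ F, E a k := Finset.sum_nonneg fun k _ => hE0 a k
  have hOa0 : 0 ≤ Eo a 0 + β * ∑ J ∈ Wset.erase 0, Eo a J :=
    add_nonneg (hEo0 a 0) (mul_nonneg hβ0 (Finset.sum_nonneg fun J _ => hEo0 a J))
  have hIa0 : 0 ≤ Ei a 0 + β * ∑ J ∈ Wset.erase 0, Ei a J :=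
    add_nonneg (hEi0 a 0) (mul_nonneg hβ0 (Finset.sum_nonneg fun J _ => hEi0 a J))
  have hmF : θF ≤ max θF (max θo θi) := le_max_left _ _
  have hmo : θo ≤ max θF (max θo θi) := (le_max_left _ _).trans (le_max_right _ _)
  have hmi : θi ≤ max θF (max θo θi) := (le_max_right _ _).trans (le_max_right _ _)
  -- `Ψ(a) ≥ 0`: the slow pair lies in the ball and is distinct
  have hΨa0 : 0 ≤ β * ∑ k ∈ freqBall N, E a k - (β - 1) * (E a ℓ + E a (-ℓ)) := by
    have hℓS : ℓ ∈ freqBall N := by have := (hW 0).1 h0; simpa using this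
    have hℓS' : -ℓ ∈ freqBall N := neg_mem_freqBall_of_mem _ hℓS
    have hℓne : ℓ ≠ -ℓ := by have := hdisj 0 0; simpa using this
    have hsub2 : ({ℓ, -ℓ} : Finset (Fin 3 → ℤ)) ⊆ freqBall N := by
      intro k hk'
      simp only [Finset.mem_insert, Finset.mem_singleton] at hk'
      rcases hk' with rfl | rfl
      · exact hℓS
      · exact hℓS'
    have hpair := Finset.sum_le_sum_of_subset_of_nonneg hsub2 (fun k _ _ => hE0 a k)
    rw [Finset.sum_pair hℓne] at hpair
    have hS0 : 0 ≤ E a ℓ + E a (-ℓ) := add_nonneg (hE0 a ℓ) (hE0 a (-ℓ))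
    have hβS := mul_le_mul_of_nonneg_left hpair (zero_le_one.trans hβ)
    linarith only [hβS, hS0]
  have hgoal : β * ∑ k ∈ freqBall N, E b k - (β - 1) * (E b ℓ + E b (-ℓ)) ≤
      max θF (max θo θi) * (β * ∑ k ∈ freqBall N, E a k - (β - 1) * (E a ℓ + E a (-ℓ))) := by
    rw [hΨ b, hΨ a]
    have t1 : β * ∑ k ∈ F, E b k ≤ max θF (max θo θi) * (β * ∑ k ∈ F, E a k) := by
      have u1 := mul_le_mul_of_nonneg_left hFdec hβ0
      have u2 : β * (θF * ∑ k ∈ F, E a k) ≤ β * (max θF (max θo θi) * ∑ k ∈ F, E a k) :=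
        mul_le_mul_of_nonneg_left (mul_le_mul_of_nonneg_right hmF hFa0) hβ0
      have e : β * (max θF (max θo θi) * ∑ k ∈ F, E a k) = max θF (max θo θi) * (β * ∑ k ∈ F, E a k) := by ring
      linarith only [u1, u2, e]
    have t2 : Eo b 0 + β * ∑ J ∈ Wset.erase 0, Eo b J ≤ max θF (max θo θi) * (Eo a 0 + β * ∑ J ∈ Wset.erase 0, Eo a J) :=
      hout'.trans (mul_le_mul_of_nonneg_right hmo hOa0)
    have t3 : Ei b 0 + β * ∑ J ∈ Wset.erase 0, Ei b J ≤ max θF (max θo θi) * (Ei a 0 + β * ∑ J ∈ Wset.erase 0, Ei a J) :=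
      hin'.trans (mul_le_mul_of_nonneg_right hmi hIa0)
    linarith only [t1, t2, t3]
  have hfin := hgoal.trans (mul_le_mul_of_nonneg_right hΘ hΨa0)
  simpa only [hE] using hfin

end Summit.AnomalousDissipation.AnomalousDissipation.Theorems.SolenoidalFractalHomogenisation.RealisedQuasiStaticCellLaw

end
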